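import Summits.BirchSwinnertonDyer.BirchSwinnertonDyer.Theorems.Rank2ObservatoryPSatWitness
import Summits.BirchSwinnertonDyer.BirchSwinnertonDyer.Theorems.Rank2ObservatoryRank3SatCertT
import HarnessLib

/-!
# BirchSwinnertonDyer — rank ≥ 2 observatory: rank-3 `p`-saturation certificates (lane `u = 0`)

HONEST FRAMING: per-curve certified theorems and census instruments; no claim on BSD in rank ≥ 2.

The ROW CERTIFICATE of the next kernel instrument: for a row `r` of the rank-3 table and an odd
prime `p` NOT dividing the certified torsion annihilator `t` (lane `u = 0`: `E(ℚ)[p] = 0`), a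
kernel-decidable datum `Rank3PSatCert` proving that the listed span
`ℤP₁ + ℤP₂ + ℤP₃ + E(ℚ)_tors` of the listed generators is `p`-SATURATED in `E(ℚ) = r.curve⟮ℚ⟯`
(`∀ a, p • a ∈ span → a ∈ span`; Siksek 1995 §3): the scale `d` and the integral points
`(Xᵢ, Yᵢ)` on `V = scaleModel r.intModel d`, kernel counts `S` with `annihilatorCheck S t`, the
witness primes with their counts `Q = [(q, #Ẽ(𝔽_q)), …]` (checked ONCE by `killerB`), and for
every residue triple `(a, b, c) ∈ {0, …, p−1}³ ∖ 0` a `PWitness` — a prime `(q, N) ∈ Q` with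
`N = p · k` and a three-generator addition chain exhibiting `(ka)P̃₁ + (kb)P̃₂ + (kc)P̃₃` as an
affine point of `Ẽ(𝔽_q)` (`Rank2ObservatoryPSatWitness.not_mem_pCoset_zero_of_chain3`).

* `triples p` / `mem_triples` — the residue triples, as a computable list;
* `PWitness`, `pWitnessB`, `not_mem_pCoset_of_pWitnessB` — one witness and its soundness;
* `pSaturated_of_certP` — on the scaled model: annihilator (`nsmul_eq_zero_of_annihilatorCheck`)
  + `p ∤ t` + all residue witnesses ⇒ `p`-saturated (`listedSpan_saturated_of_not_mem_pCoset`);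
* `Rank3Row.pSaturated_of_scaled` — transport to the census equation (as
  `Rank3Row.twoSaturated_of_scaled`, `saturated_map`);
* `Rank3PSatCert`, `rank3PSatCheck`, `Rank3Row.pSaturated_of_pSatCheck`, and the list form
  `rank3PSatCheckAll` / `Rank3Row.pSaturated_of_pSatCheckAll` for machine-written data files.

With the landed `2`-instrument (`SatCensus.finiteIndex_and_odd_index_of_mem_rows`: finite ODD
index) a certified row then has index prime to `2p` (`not_dvd_index_listedSpan`). Rows with
`p ∣ t`, and rows whose span is not `p`-saturated, get no certificate here (listed, never hidden).
Sorry-free; no `decide` executed in this file.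

References: S. Siksek, Rocky Mountain J. Math. 25 (1995) §3; J. E. Cremona, *Algorithms for
Modular Elliptic Curves* (2nd ed. 1997), §3.5; J. H. Silverman, AEC (2nd ed. 2009), VII.3.
-/

-- single-conjunct summit: `Summit.BirchSwinnertonDyer.BirchSwinnertonDyer.…` repeats the name
set_option linter.dupNamespace false

namespace Summit.BirchSwinnertonDyer.BirchSwinnertonDyer.Rank2Observatory

open WeierstrassCurve Literature.NumberTheory.EllipticCurves

/-! ### Residue triples -/

/-- All triples `(a, b, c)` with `0 ≤ a, b, c < p` (integers), as a list. [folklore] -/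
def triples (p : ℕ) : List (ℤ × ℤ × ℤ) :=
  (List.range p).flatMap fun a : ℕ => (List.range p).flatMap fun b : ℕ =>
    (List.range p).map fun c : ℕ => (((a : ℕ) : ℤ), ((b : ℕ) : ℤ), ((c : ℕ) : ℤ))

/-- Every residue triple is listed. [folklore] -/
theorem mem_triples {p : ℕ} {a b c : ℤ} (ha : 0 ≤ a) (ha' : a < p) (hb : 0 ≤ b) (hb' : b < p)
    (hc : 0 ≤ c) (hc' : c < p) : (a, b, c) ∈ triples p := by
  obtain ⟨a, rfl⟩ := Int.eq_ofNat_of_zero_le ha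
  obtain ⟨b, rfl⟩ := Int.eq_ofNat_of_zero_le hb
  obtain ⟨c, rfl⟩ := Int.eq_ofNat_of_zero_le hc
  have ha₁ : a < p := by exact_mod_cast ha'
  have hb₁ : b < p := by exact_mod_cast hb'
  have hc₁ : c < p := by exact_mod_cast hc'
  exact List.mem_flatMap.mpr ⟨a, List.mem_range.mpr ha₁, List.mem_flatMap.mpr
    ⟨b, List.mem_range.mpr hb₁, List.mem_map.mpr ⟨c, List.mem_range.mpr hc₁, rfl⟩⟩⟩

/-! ### One witness -/

/-- WITNESS DATA for one residue class `(a, b, c)`: a witness prime `q` with its count `N = p · k`,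
the start generator `s₀` and the chain `steps` (operations with the claimed points, integers read
modulo `q`) reaching the coefficients `(k a, k b, k c)`. [cite: CremonaAlgorithms1997, §3.5] -/
structure PWitness where
  /-- residue coefficient of `P₁` -/
  a : ℤ
  /-- residue coefficient of `P₂` -/
  b : ℤ
  /-- residue coefficient of `P₃` -/
  c : ℤ
  /-- witness prime -/
  q : ℕ
  /-- `#Ẽ(𝔽_q)` -/
  N : ℕ
  /-- `N / p` -/
  k : ℕ
  /-- start generator of the chain -/
  s₀ : Op
  /-- the chain: operations with the claimed points -/
  steps : List (Op × ℤ × ℤ)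

/-- The chain read modulo `q`. [folklore] -/
def PWitness.zsteps (w : PWitness) (q : ℕ) : List (Op × ZMod q × ZMod q) :=
  w.steps.map fun s => (s.1, ((s.2.1 : ℤ) : ZMod q), ((s.2.2 : ℤ) : ZMod q))

/-- WITNESS CHECK (a Boolean for `decide`): `(q, N)` is one of the certified witness primes `Q`,
`N = p · k`, the chain checks from the start generator, and it reaches `(k a, k b, k c)`;
`q = 0` rejected. [cite: CremonaAlgorithms1997, §3.5] -/
def pWitnessB (V : WeierstrassCurve ℤ) (p : ℕ) (Q : List (ℕ × ℕ)) (X₁ Y₁ X₂ Y₂ X₃ Y₃ : ℤ)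
    (w : PWitness) : Bool :=
  match w.q with
  | 0 => false
  | q + 1 =>
    let g₁ : ZMod (q + 1) × ZMod (q + 1) := ((X₁ : ZMod (q + 1)), (Y₁ : ZMod (q + 1)))
    let g₂ : ZMod (q + 1) × ZMod (q + 1) := ((X₂ : ZMod (q + 1)), (Y₂ : ZMod (q + 1)))
    let g₃ : ZMod (q + 1) × ZMod (q + 1) := ((X₃ : ZMod (q + 1)), (Y₃ : ZMod (q + 1)))
    decide ((q + 1, w.N) ∈ Q) && decide (w.N = p * w.k) &&
      chain3B V (q + 1) g₁ g₂ g₃ (startPt g₁ g₂ g₃ w.s₀) (w.zsteps (q + 1)) &&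
      decide (chain3Coeffs (startCoeffs w.s₀) (w.zsteps (q + 1)) =
        ((w.k : ℤ) * w.a, (w.k : ℤ) * w.b, (w.k : ℤ) * w.c))

/-- One certified count `(q, N)`: `q` a good prime with `#Ẽ(𝔽_q) = N`. [folklore] -/
theorem killerB_sound (V : WeierstrassCurve ℤ) {q N : ℕ} (h : killerB V (q + 1, N) = true) :
    (q + 1).Prime ∧ ¬ ((q + 1 : ℕ) : ℤ) ∣ V.Δ ∧ zmodPointCount V (q + 1) = N := by
  simp only [killerB, goodPrimeB, Bool.and_eq_true, decide_eq_true_eq, beq_iff_eq] at h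
  exact ⟨h.1.1, h.1.2, h.2⟩

open scoped Classical in
/-- **Soundness of one witness**: `aP₁ + bP₂ + cP₃ ∉ p•E'(ℚ) = pCoset E'(ℚ) p 0` for the integral
points `Pᵢ = (Xᵢ, Yᵢ)` of `E' = V` (`not_mem_pCoset_zero_of_chain3` with the reductions
`reduceMod_some`). [cite: SilvermanAEC2009, VII.3] -/
theorem not_mem_pCoset_of_pWitnessB (V : WeierstrassCurve ℤ) (hΔ : V.Δ ≠ 0) {p : ℕ}
    {Q : List (ℕ × ℕ)} (hQ : Q.all (killerB V) = true) {X₁ Y₁ X₂ Y₂ X₃ Y₃ : ℤ}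
    (e₁ : Y₁ ^ 2 + V.a₁ * X₁ * Y₁ + V.a₃ * Y₁ = X₁ ^ 3 + V.a₂ * X₁ ^ 2 + V.a₄ * X₁ + V.a₆)
    (e₂ : Y₂ ^ 2 + V.a₁ * X₂ * Y₂ + V.a₃ * Y₂ = X₂ ^ 3 + V.a₂ * X₂ ^ 2 + V.a₄ * X₂ + V.a₆)
    (e₃ : Y₃ ^ 2 + V.a₁ * X₃ * Y₃ + V.a₃ * Y₃ = X₃ ^ 3 + V.a₂ * X₃ ^ 2 + V.a₄ * X₃ + V.a₆)
    {w : PWitness} (hw : pWitnessB V p Q X₁ Y₁ X₂ Y₂ X₃ Y₃ w = true) :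
    w.a • (Affine.Point.some (X₁ : ℚ) (Y₁ : ℚ) (nonsingular_rat_of_eq V hΔ e₁) :
        (V.map (Int.castRingHom ℚ)).toAffine.Point)
      + w.b • Affine.Point.some (X₂ : ℚ) (Y₂ : ℚ) (nonsingular_rat_of_eq V hΔ e₂)
      + w.c • Affine.Point.some (X₃ : ℚ) (Y₃ : ℚ) (nonsingular_rat_of_eq V hΔ e₃) ∉
      pCoset (V.map (Int.castRingHom ℚ)).toAffine.Point p 0 := by
  obtain ⟨a, b, c, q, N, k, s₀, steps⟩ := w
  cases q with
  | zero => simp [pWitnessB] at hw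
  | succ q =>
    simp only [pWitnessB, Bool.and_eq_true, decide_eq_true_eq] at hw
    obtain ⟨⟨⟨hmem, hNk⟩, hchain⟩, hcoef⟩ := hw
    obtain ⟨hprime, hq, hcount⟩ := killerB_sound V (List.all_eq_true.mp hQ _ hmem)
    haveI : Fact (q + 1).Prime := ⟨hprime⟩
    have E₁ : V.toAffine.Equation X₁ Y₁ := (Affine.equation_iff X₁ Y₁).mpr e₁
    have E₂ : V.toAffine.Equation X₂ Y₂ := (Affine.equation_iff X₂ Y₂).mpr e₂
    have E₃ : V.toAffine.Equation X₃ Y₃ := (Affine.equation_iff X₃ Y₃).mpr e₃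
    exact not_mem_pCoset_zero_of_chain3 V (q + 1) hq (p := p) (k := k) (by rw [hcount, hNk])
      _ _ _ (reduceMod_some V (q + 1) hq E₁ _) (reduceMod_some V (q + 1) hq E₂ _)
      (reduceMod_some V (q + 1) hq E₃ _) s₀ hchain hcoef

/-! ### The certificate on the scaled model -/

open scoped Classical in
/-- **`p`-saturation on the integral model.** `p` prime, `p ∤ t` where `t` (from
`annihilatorCheck S t` and the kernel counts `S`) kills `E(ℚ)_tors`, and a checked witness for
every residue triple `≠ 0` ⇒ the listed span of `P₁, P₂, P₃` is `p`-saturated in `E'(ℚ)`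
(`listedSpan_saturated_of_not_mem_pCoset` with `u = 0`, `m = t`).
[cite: CremonaAlgorithms1997, §3.5] [cite: SilvermanAEC2009, Prop. VII.3.1(b)] -/
theorem pSaturated_of_certP (V : WeierstrassCurve ℤ) (hΔ : V.Δ ≠ 0) {X₁ Y₁ X₂ Y₂ X₃ Y₃ : ℤ}
    (e₁ : Y₁ ^ 2 + V.a₁ * X₁ * Y₁ + V.a₃ * Y₁ = X₁ ^ 3 + V.a₂ * X₁ ^ 2 + V.a₄ * X₁ + V.a₆)
    (e₂ : Y₂ ^ 2 + V.a₁ * X₂ * Y₂ + V.a₃ * Y₂ = X₂ ^ 3 + V.a₂ * X₂ ^ 2 + V.a₄ * X₂ + V.a₆)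
    (e₃ : Y₃ ^ 2 + V.a₁ * X₃ * Y₃ + V.a₃ * Y₃ = X₃ ^ 3 + V.a₂ * X₃ ^ 2 + V.a₄ * X₃ + V.a₆)
    {p : ℕ} (hp : p.Prime) {S : List (ℕ × ℕ)} {t : ℕ}
    (hS : ∀ ℓN ∈ S, ℓN.1.Prime ∧
      ∀ (x : (V.map (Int.castRingHom ℚ)).toAffine.Point) (n : ℕ), ¬ ℓN.1 ∣ n → n • x = 0 →
        ℓN.2 • x = 0)
    (ht : annihilatorCheck S t = true) (hpt : ¬ (p : ℤ) ∣ (t : ℤ)) {Q : List (ℕ × ℕ)}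
    (hQ : Q.all (killerB V) = true) {ws : List PWitness}
    (hall : (triples p).all (fun abc => decide (abc = (0, 0, 0)) ||
      ws.any fun w => decide ((w.a, w.b, w.c) = abc) && pWitnessB V p Q X₁ Y₁ X₂ Y₂ X₃ Y₃ w)
      = true) :
    ∀ x : (V.map (Int.castRingHom ℚ)).toAffine.Point,
      p • x ∈ AddSubgroup.closure
          {Affine.Point.some (X₁ : ℚ) (Y₁ : ℚ) (nonsingular_rat_of_eq V hΔ e₁),
            Affine.Point.some (X₂ : ℚ) (Y₂ : ℚ) (nonsingular_rat_of_eq V hΔ e₂),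
            Affine.Point.some (X₃ : ℚ) (Y₃ : ℚ) (nonsingular_rat_of_eq V hΔ e₃)} ⊔
          AddCommGroup.torsion _ →
      x ∈ AddSubgroup.closure
          {Affine.Point.some (X₁ : ℚ) (Y₁ : ℚ) (nonsingular_rat_of_eq V hΔ e₁),
            Affine.Point.some (X₂ : ℚ) (Y₂ : ℚ) (nonsingular_rat_of_eq V hΔ e₂),
            Affine.Point.some (X₃ : ℚ) (Y₃ : ℚ) (nonsingular_rat_of_eq V hΔ e₃)} ⊔
          AddCommGroup.torsion _ := by
  refine listedSpan_saturated_of_not_mem_pCoset hp (u := 0) (m := (t : ℤ))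
    (isCoprime_of_prime_of_not_dvd hp hpt) ?_ ?_
  · intro x hx
    rw [pow_zero, one_mul, natCast_zsmul]
    exact nsmul_eq_zero_of_annihilatorCheck hS ht hx
  · intro a b c ha ha' hb hb' hc hc' hne
    have h1 := List.all_eq_true.mp hall _ (mem_triples ha ha' hb hb' hc hc')
    simp only [Bool.or_eq_true, decide_eq_true_eq, List.any_eq_true, Bool.and_eq_true] at h1
    rcases h1 with h0 | ⟨w, -, hwabc, hwB⟩
    · simp only [Prod.mk.injEq] at h0
      exact (hne h0).elim
    · simp only [Prod.mk.injEq] at hwabc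
      obtain ⟨rfl, rfl, rfl⟩ := hwabc
      exact not_mem_pCoset_of_pWitnessB V hΔ hQ e₁ e₂ e₃ hwB

/-! ### Transport from the scaled model to the census equation -/

section Transport

/-- Transport of `Point.some` along equal coordinates. [folklore] -/
private theorem some_eq_some {W : Affine ℚ} {x y x' y' : ℚ} (hx : x = x') (hy : y = y')
    {h : W.Nonsingular x y} {h' : W.Nonsingular x' y'} :
    Affine.Point.some x y h = .some x' y' h' := by
  subst hx hy
  rfl

/-- The scaled coordinate: `X'·Z = d^k·X` gives `d^k · (X/Z) = X'` over `ℚ`. [folklore] -/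
private theorem scaled_coord {X' Z X d : ℤ} (k : ℕ) (hZ : Z ≠ 0) (h : X' * Z = d ^ k * X) :
    (d : ℚ) ^ k * ((X : ℚ) / Z) = X' := by
  have hZ' : (Z : ℚ) ≠ 0 := by exact_mod_cast hZ
  rw [← mul_div_assoc, div_eq_iff hZ']
  exact_mod_cast h.symm

end Transport

namespace Rank3Row

/-- **TRANSPORT for `p`-saturation**: `p`-saturation of the listed span of the integral points
`(Xᵢ, Yᵢ)` on `V = scaleModel r.intModel d` (`d ≠ 0`), whose coordinates are the listed
generators' scaled by `(d², d³)`, gives `p`-saturation of the listed span of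
`r.gen₁, r.gen₂, r.gen₃` in `E(ℚ) = r.curve⟮ℚ⟯` (as `twoSaturated_of_scaled`; `saturated_map`).
[cite: SilvermanAEC2009, III.3.1(b)] -/
theorem pSaturated_of_scaled (r : Rank3Row) (h : r.check = true) {d : ℤ} (hd : d ≠ 0)
    {X₁ Y₁ X₂ Y₂ X₃ Y₃ : ℤ}
    (hX₁ : X₁ * r.P₁.2.2 = d ^ 2 * r.P₁.1) (hY₁ : Y₁ * r.P₁.2.2 = d ^ 3 * r.P₁.2.1)
    (hX₂ : X₂ * r.P₂.2.2 = d ^ 2 * r.P₂.1) (hY₂ : Y₂ * r.P₂.2.2 = d ^ 3 * r.P₂.2.1)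
    (hX₃ : X₃ * r.P₃.2.2 = d ^ 2 * r.P₃.1) (hY₃ : Y₃ * r.P₃.2.2 = d ^ 3 * r.P₃.2.1)
    (hΔ : (scaleModel r.intModel d).Δ ≠ 0)
    (e₁ : Y₁ ^ 2 + (scaleModel r.intModel d).a₁ * X₁ * Y₁ + (scaleModel r.intModel d).a₃ * Y₁ =
      X₁ ^ 3 + (scaleModel r.intModel d).a₂ * X₁ ^ 2 + (scaleModel r.intModel d).a₄ * X₁ +
        (scaleModel r.intModel d).a₆)
    (e₂ : Y₂ ^ 2 + (scaleModel r.intModel d).a₁ * X₂ * Y₂ + (scaleModel r.intModel d).a₃ * Y₂ =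
      X₂ ^ 3 + (scaleModel r.intModel d).a₂ * X₂ ^ 2 + (scaleModel r.intModel d).a₄ * X₂ +
        (scaleModel r.intModel d).a₆)
    (e₃ : Y₃ ^ 2 + (scaleModel r.intModel d).a₁ * X₃ * Y₃ + (scaleModel r.intModel d).a₃ * Y₃ =
      X₃ ^ 3 + (scaleModel r.intModel d).a₂ * X₃ ^ 2 + (scaleModel r.intModel d).a₄ * X₃ +
        (scaleModel r.intModel d).a₆)
    (p : ℕ)
    (H : ∀ a : ((scaleModel r.intModel d).map (Int.castRingHom ℚ)).toAffine.Point,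
      p • a ∈ AddSubgroup.closure
          {Affine.Point.some (X₁ : ℚ) (Y₁ : ℚ) (nonsingular_rat_of_eq _ hΔ e₁),
            Affine.Point.some (X₂ : ℚ) (Y₂ : ℚ) (nonsingular_rat_of_eq _ hΔ e₂),
            Affine.Point.some (X₃ : ℚ) (Y₃ : ℚ) (nonsingular_rat_of_eq _ hΔ e₃)} ⊔
          AddCommGroup.torsion _ →
      a ∈ AddSubgroup.closure
          {Affine.Point.some (X₁ : ℚ) (Y₁ : ℚ) (nonsingular_rat_of_eq _ hΔ e₁),
            Affine.Point.some (X₂ : ℚ) (Y₂ : ℚ) (nonsingular_rat_of_eq _ hΔ e₂),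
            Affine.Point.some (X₃ : ℚ) (Y₃ : ℚ) (nonsingular_rat_of_eq _ hΔ e₃)} ⊔
          AddCommGroup.torsion _) :
    ∀ a : r.curve.toAffine.Point,
      p • a ∈ AddSubgroup.closure {r.gen₁ h, r.gen₂ h, r.gen₃ h} ⊔ AddCommGroup.torsion _ →
        a ∈ AddSubgroup.closure {r.gen₁ h, r.gen₂ h, r.gen₃ h} ⊔ AddCommGroup.torsion _ := by
  classical
  have hd' : (d : ℚ) ≠ 0 := by exact_mod_cast hd
  let C : VariableChange ℚ := ⟨(Units.mk0 (d : ℚ) hd')⁻¹, 0, 0, 0⟩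
  have hVC : C • r.curve = (scaleModel r.intModel d).map (Int.castRingHom ℚ) := by
    rw [r.curve_eq_map_intModel]
    exact (map_scaleModel_eq_smul r.intModel hd).symm
  let e : r.curve.toAffine.Point ≃+
      ((scaleModel r.intModel d).map (Int.castRingHom ℚ)).toAffine.Point :=
    (VariableChange.pointEquiv r.curve C).trans (Affine.Point.congrEquiv hVC)
  have hCx : ∀ x : ℚ, C.toX x = (d : ℚ) ^ 2 * x := by
    intro x
    simp only [VariableChange.toX_def, C, inv_inv, Units.val_mk0, sub_zero]
  have hCy : ∀ x y : ℚ, C.toY x y = (d : ℚ) ^ 3 * y := by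
    intro x y
    simp only [VariableChange.toY_def, C, inv_inv, Units.val_mk0, sub_zero, zero_mul]
  obtain ⟨-, hP₁, hP₂, hP₃, -⟩ := r.check_spec h
  have hZ₁ : r.P₁.2.2 ≠ 0 := (of_decide_eq_true hP₁).1
  have hZ₂ : r.P₂.2.2 ≠ 0 := (of_decide_eq_true hP₂).1
  have hZ₃ : r.P₃.2.2 ≠ 0 := (of_decide_eq_true hP₃).1
  have eg₁ : e (r.gen₁ h) = .some (X₁ : ℚ) (Y₁ : ℚ) (nonsingular_rat_of_eq _ hΔ e₁) := by
    simp only [e, AddEquiv.trans_apply, Rank3Row.gen₁, VariableChange.pointEquiv_some,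
      Affine.Point.congrEquiv_some]
    exact some_eq_some (by rw [hCx]; exact scaled_coord 2 hZ₁ hX₁)
      (by rw [hCy]; exact scaled_coord 3 hZ₁ hY₁)
  have eg₂ : e (r.gen₂ h) = .some (X₂ : ℚ) (Y₂ : ℚ) (nonsingular_rat_of_eq _ hΔ e₂) := by
    simp only [e, AddEquiv.trans_apply, Rank3Row.gen₂, VariableChange.pointEquiv_some,
      Affine.Point.congrEquiv_some]
    exact some_eq_some (by rw [hCx]; exact scaled_coord 2 hZ₂ hX₂)
      (by rw [hCy]; exact scaled_coord 3 hZ₂ hY₂)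
  have eg₃ : e (r.gen₃ h) = .some (X₃ : ℚ) (Y₃ : ℚ) (nonsingular_rat_of_eq _ hΔ e₃) := by
    simp only [e, AddEquiv.trans_apply, Rank3Row.gen₃, VariableChange.pointEquiv_some,
      Affine.Point.congrEquiv_some]
    exact some_eq_some (by rw [hCx]; exact scaled_coord 2 hZ₃ hX₃)
      (by rw [hCy]; exact scaled_coord 3 hZ₃ hY₃)
  have es₁ : e.symm (.some (X₁ : ℚ) (Y₁ : ℚ) (nonsingular_rat_of_eq _ hΔ e₁)) = r.gen₁ h := by
    rw [← eg₁, AddEquiv.symm_apply_apply]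
  have es₂ : e.symm (.some (X₂ : ℚ) (Y₂ : ℚ) (nonsingular_rat_of_eq _ hΔ e₂)) = r.gen₂ h := by
    rw [← eg₂, AddEquiv.symm_apply_apply]
  have es₃ : e.symm (.some (X₃ : ℚ) (Y₃ : ℚ) (nonsingular_rat_of_eq _ hΔ e₃)) = r.gen₃ h := by
    rw [← eg₃, AddEquiv.symm_apply_apply]
  have hsat' := saturated_map e.symm p H
  rw [es₁, es₂, es₃] at hsat'
  exact hsat'

end Rank3Row

/-! ### The row certificate -/

/-- The `p`-SATURATION CERTIFICATE of a rank-3 row (lane `u = 0`): scale `d`, the integral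
points `(Xᵢ, Yᵢ)` on `scaleModel _ d`, kernel counts `S` and the torsion annihilator `t`, the
witness primes with counts `Q`, and the residue witnesses `ws`. Pure data; checked by
`rank3PSatCheck`. [cite: CremonaAlgorithms1997, §3.5] -/
structure Rank3PSatCert where
  /-- scale of the integral model -/
  d : ℤ
  /-- `x`-coordinate of the first scaled generator -/
  X₁ : ℤ
  /-- `y`-coordinate of the first scaled generator -/
  Y₁ : ℤ
  /-- `x`-coordinate of the second scaled generator -/
  X₂ : ℤ
  /-- `y`-coordinate of the second scaled generator -/
  Y₂ : ℤ
  /-- `x`-coordinate of the third scaled generator -/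
  X₃ : ℤ
  /-- `y`-coordinate of the third scaled generator -/
  Y₃ : ℤ
  /-- kernel point counts `(ℓ, #Ẽ(𝔽_ℓ))` for the annihilator -/
  S : List (ℕ × ℕ)
  /-- torsion annihilator -/
  t : ℕ
  /-- witness primes with counts `(q, #Ẽ(𝔽_q))` -/
  Q : List (ℕ × ℕ)
  /-- residue witnesses -/
  ws : List PWitness

/-- **The row Boolean** (kernel `decide`): with `V = scaleModel r.intModel c.d` — `d ≠ 0`,
`Δ(V) ≠ 0`, `p` prime, `p ∤ t`; the scaled coordinates match the row's projective generators;
the three integral Weierstrass equations; `annihilatorCheck`; `S` and `Q` pass `killerB`; every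
residue triple `≠ 0` has a checked witness. [cite: CremonaAlgorithms1997, §3.5] -/
def rank3PSatCheck (r : Rank3Row) (p : ℕ) (c : Rank3PSatCert) : Bool :=
  let V := scaleModel r.intModel c.d
  decide (c.d ≠ 0 ∧ V.Δ ≠ 0 ∧ p.Prime ∧ ¬ (p : ℤ) ∣ (c.t : ℤ) ∧
      c.X₁ * r.P₁.2.2 = c.d ^ 2 * r.P₁.1 ∧ c.Y₁ * r.P₁.2.2 = c.d ^ 3 * r.P₁.2.1 ∧
      c.X₂ * r.P₂.2.2 = c.d ^ 2 * r.P₂.1 ∧ c.Y₂ * r.P₂.2.2 = c.d ^ 3 * r.P₂.2.1 ∧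
      c.X₃ * r.P₃.2.2 = c.d ^ 2 * r.P₃.1 ∧ c.Y₃ * r.P₃.2.2 = c.d ^ 3 * r.P₃.2.1 ∧
      c.Y₁ ^ 2 + V.a₁ * c.X₁ * c.Y₁ + V.a₃ * c.Y₁ =
        c.X₁ ^ 3 + V.a₂ * c.X₁ ^ 2 + V.a₄ * c.X₁ + V.a₆ ∧
      c.Y₂ ^ 2 + V.a₁ * c.X₂ * c.Y₂ + V.a₃ * c.Y₂ =
        c.X₂ ^ 3 + V.a₂ * c.X₂ ^ 2 + V.a₄ * c.X₂ + V.a₆ ∧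
      c.Y₃ ^ 2 + V.a₁ * c.X₃ * c.Y₃ + V.a₃ * c.Y₃ =
        c.X₃ ^ 3 + V.a₂ * c.X₃ ^ 2 + V.a₄ * c.X₃ + V.a₆) &&
  annihilatorCheck c.S c.t && c.S.all (killerB V) && c.Q.all (killerB V) &&
  (triples p).all fun abc => decide (abc = (0, 0, 0)) ||
    c.ws.any fun w => decide ((w.a, w.b, w.c) = abc) &&
      pWitnessB V p c.Q c.X₁ c.Y₁ c.X₂ c.Y₂ c.X₃ c.Y₃ w

/-- **SOUNDNESS of the row certificate**: if `rank3PSatCheck r p c = true` (and the row checks)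
then the listed span `ℤP₁ + ℤP₂ + ℤP₃ + E(ℚ)_tors` of the listed generators is `p`-SATURATED in
`E(ℚ) = r.curve⟮ℚ⟯`. [cite: CremonaAlgorithms1997, §3.5] [cite: SilvermanAEC2009, III.3.1(b)] -/
theorem Rank3Row.pSaturated_of_pSatCheck (r : Rank3Row) (h : r.check = true) (p : ℕ)
    (c : Rank3PSatCert) (hc : rank3PSatCheck r p c = true) :
    ∀ a : r.curve.toAffine.Point,
      p • a ∈ AddSubgroup.closure {r.gen₁ h, r.gen₂ h, r.gen₃ h} ⊔ AddCommGroup.torsion _ →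
        a ∈ AddSubgroup.closure {r.gen₁ h, r.gen₂ h, r.gen₃ h} ⊔ AddCommGroup.torsion _ := by
  simp only [rank3PSatCheck, Bool.and_eq_true, decide_eq_true_eq] at hc
  obtain ⟨⟨⟨⟨⟨hd, hΔ, hp, hpt, hX₁, hY₁, hX₂, hY₂, hX₃, hY₃, e₁, e₂, e₃⟩, hann⟩, hS⟩, hQ⟩,
    hall⟩ := hc
  exact r.pSaturated_of_scaled h hd hX₁ hY₁ hX₂ hY₂ hX₃ hY₃ hΔ e₁ e₂ e₃ p
    (pSaturated_of_certP _ hΔ e₁ e₂ e₃ hp (killers_of_all_killerB _ hS) hann hpt hQ hall)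

/-- The Boolean over a list of rows and certificates (same order). [folklore] -/
def rank3PSatCheckAll (p : ℕ) : List Rank3Row → List Rank3PSatCert → Bool
  | [], _ => true
  | _ :: _, [] => false
  | r :: rs, c :: cs => rank3PSatCheck r p c && rank3PSatCheckAll p rs cs

/-- **Soundness of the list form.** [cite: CremonaAlgorithms1997, §3.5] -/
theorem Rank3Row.pSaturated_of_pSatCheckAll (p : ℕ) :
    ∀ {rows : List Rank3Row} {cs : List Rank3PSatCert}, rank3PSatCheckAll p rows cs = true →
      ∀ r ∈ rows, ∀ h : r.check = true, ∀ a : r.curve.toAffine.Point,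
        p • a ∈ AddSubgroup.closure {r.gen₁ h, r.gen₂ h, r.gen₃ h} ⊔ AddCommGroup.torsion _ →
          a ∈ AddSubgroup.closure {r.gen₁ h, r.gen₂ h, r.gen₃ h} ⊔ AddCommGroup.torsion _
  | [], _, _ => by simp
  | _ :: _, [], hc => by simp [rank3PSatCheckAll] at hc
  | r :: rs, c :: cs, hc => by
    rw [rank3PSatCheckAll, Bool.and_eq_true] at hc
    intro r' hr'
    rcases List.mem_cons.mp hr' with rfl | hmem
    · exact fun h => r'.pSaturated_of_pSatCheck h p c hc.1
    · exact Rank3Row.pSaturated_of_pSatCheckAll p hc.2 r' hmem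

end Summit.BirchSwinnertonDyer.BirchSwinnertonDyer.Rank2Observatory
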